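import Literature.AlgebraicGeometry.Dimension.PointDimension
import Literature.AlgebraicGeometry.Motives.SubschemeCyclesDimProofs
import Literature.Topology.KrullDimensionDrop
import Mathlib.AlgebraicGeometry.Noetherian
import Mathlib.Topology.KrullDimension
import Mathlib.Order.KrullDimension
import HarnessLib

/-!
# `ModificationsResolve` (crux stmt-ResolutionOfSingularities-18507), line `Sketch` —
stub `stub_topologicalKrullDim_le_of_isIso_restrict` (card `dense-open-dimension`)

Helper file (`--supports stmt-ResolutionOfSingularities-18507`; does not close the item).

The one non-plumbing step of the one-step well-founded induction (CJS Cor. 6.18): along a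
Σ^max-modification `π : X' ⟶ X` — an isomorphism over the open `U = X ∖ X_max` whose preimage
`π⁻¹(U)` is dense in `X'` — the dimension does not increase, `dim X' ≤ dim X`, for `X` locally of
finite type over a field `K`, `π` locally of finite type and `X'` Noetherian; `X'` may be reducible.

Proof.
* `height_apply_eq_height_of_isOpenImmersion`: the height of a point (Krull dimension of its
  closure) is LOCAL on schemes locally of finite type over a field — unchanged along an open
  immersion `j : U ⟶ X` — by the dimension formula
  `height u = height (j u) + height (fibre point)` (Stacks 02JW, tree
  `Literature.AlgebraicGeometry.Motives.Scheme.height_eq_height_add_height_asFiber`), the fibre of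
  an open immersion over a point of its image being a single point (Mathlib `Scheme.Hom.fiberHomeo`).
* `topologicalKrullDim_eq_of_isOpenImmersion_of_denseRange`: hence a dense open subscheme of a
  Noetherian scheme locally of finite type over a field has full dimension: `dim = ⨆ height`
  (`Order.krullDim_eq_iSup_height` through `irreducibleSetEquivPoints`), every point specialises
  from the generic point of its irreducible component, and that generic point lies in every dense
  open (an irreducible component of a Noetherian space contains a non-empty open subset,
  `NoetherianSpace.exists_isOpen_nonempty_subset_irreducibleComponent`).
* `stub_topologicalKrullDim_le_of_isIso_restrict`: `dim X' = dim π⁻¹(U) = dim U ≤ dim X`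
  (`π ∣_ U` an isomorphism, `U.ι` an embedding).

Source: V. Cossart, U. Jannsen, S. Saito, *Desingularization: Invariants and Strategy*,
LNM 2270 (2020), proof of Cor. 6.18; The Stacks Project, Tag 02JW (dimension formula).
-/

set_option linter.dupNamespace false -- mandated namespace of this single-conjunct summit

noncomputable section

open CategoryTheory AlgebraicGeometry TopologicalSpace Order

namespace Summit.ResolutionOfSingularities.ResolutionOfSingularities.Theorems.ModificationsResolve.Sketch

/-- **Heights of points are local on schemes locally of finite type over a field.** For an open
immersion `j : U ⟶ X` into a scheme `X` locally of finite type over a field `K` and `u ∈ U`,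
`height (j u) = height u` (both are `trdeg_K κ(u)`): the dimension formula
`height u = height (j u) + height (j.asFiber u)` and the fibre of `j` over `j u` is one point.
False without the finite-type hypothesis (a DVR: the generic point has height `1` in `Spec R`,
`0` in the generic fibre). [cite: StacksProject, Tag 02JW] -/
theorem height_apply_eq_height_of_isOpenImmersion {K : Type} [Field K] {U X : Scheme.{0}}
    (f : X ⟶ Spec (.of K)) [LocallyOfFiniteType f] (j : U ⟶ X) [IsOpenImmersion j] (u : U) :
    Order.height (j.base u) = Order.height u := by
  -- adapted from Cruxes/ModificationsResolve/SketchIdeator1 (card C)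
  rw [Literature.AlgebraicGeometry.Motives.Scheme.height_eq_height_add_height_asFiber j f u]
  have hsub : Subsingleton ↥(j.fiber (j.base u)) := by
    refine ⟨fun a b => (j.fiberHomeo (j.base u)).injective (Subtype.ext
      (j.isOpenEmbedding.injective ?_))⟩
    have ha := (j.fiberHomeo (j.base u) a).2
    have hb := (j.fiberHomeo (j.base u) b).2
    rw [Set.mem_preimage, Set.mem_singleton_iff] at ha hb
    exact ha.trans hb.symm
  have h0 : Order.height (j.asFiber u) = 0 := by
    rw [Order.height_eq_zero]
    exact fun z _ => (Subsingleton.elim _ z).le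
  rw [h0, add_zero]

/-- **A dense open subscheme of a Noetherian scheme locally of finite type over a field has full
dimension.** For an open immersion `j : U ⟶ X` with dense image, `X` Noetherian and locally of
finite type over a field `K`, `dim U = dim X`: `dim = ⨆ height` over points, every point `x`
specialises from the generic point `η` of its irreducible component, `η` lies in the dense open
`range j` (the component contains a non-empty open subset of `X`), and heights are local
(`height_apply_eq_height_of_isOpenImmersion`). [folklore] -/
theorem topologicalKrullDim_eq_of_isOpenImmersion_of_denseRange {K : Type} [Field K]
    {U X : Scheme.{0}} [IsNoetherian X] (f : X ⟶ Spec (.of K)) [LocallyOfFiniteType f]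
    (j : U ⟶ X) [IsOpenImmersion j] (hd : DenseRange j.base) :
    topologicalKrullDim U = topologicalKrullDim X := by
  -- adapted from Cruxes/ModificationsResolve/SketchIdeator1 (card C)
  refine le_antisymm j.isOpenEmbedding.isInducing.topologicalKrullDim_le ?_
  rw [show topologicalKrullDim X = krullDim X from
      krullDim_eq_of_orderIso (irreducibleSetEquivPoints (α := X)),
    show topologicalKrullDim U = krullDim U from
      krullDim_eq_of_orderIso (irreducibleSetEquivPoints (α := U)),
    krullDim_eq_iSup_height, krullDim_eq_iSup_height]
  refine iSup_le fun x => ?_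
  -- the generic point `η` of the irreducible component of `x` lies in the dense open `range j`
  have hirr : IsIrreducible (irreducibleComponent x) := isIrreducible_irreducibleComponent
  have hη : IsGenericPoint hirr.genericPoint (irreducibleComponent x) :=
    hirr.isGenericPoint_genericPoint isClosed_irreducibleComponent
  obtain ⟨W, hWo, hWne, hWsub⟩ := NoetherianSpace.exists_isOpen_nonempty_subset_irreducibleComponent
    (irreducibleComponent x) (irreducibleComponent_mem_irreducibleComponents x)
  obtain ⟨u₀, hu₀W⟩ := hd.exists_mem_open hWo hWne
  have hηj : hirr.genericPoint ∈ Set.range j.base :=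
    (hη.specializes (hWsub hu₀W)).mem_open j.isOpenEmbedding.isOpen_range ⟨u₀, rfl⟩
  obtain ⟨u, hu⟩ := hηj
  have hxη : x ≤ hirr.genericPoint :=
    Scheme.le_iff_specializes.mpr (hη.specializes mem_irreducibleComponent)
  calc ((height x : ℕ∞) : WithBot ℕ∞) ≤ height hirr.genericPoint := by
        exact_mod_cast height_mono hxη
    _ = height u := by rw [← hu, height_apply_eq_height_of_isOpenImmersion f j u]
    _ ≤ ⨆ v : U, ((height v : ℕ∞) : WithBot ℕ∞) :=
        le_iSup (fun v : U => ((height v : ℕ∞) : WithBot ℕ∞)) u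

/-- **STUB `stub_topologicalKrullDim_le_of_isIso_restrict` (a dense open of a finite-type
`K`-scheme has full dimension; the form the one-step induction consumes).** Along a morphism
`π : X' ⟶ X`, locally of finite type, into a scheme `X` locally of finite type over a field `K`,
which is an isomorphism over an open `U ⊆ X` whose preimage `π⁻¹(U)` is dense in the Noetherian
scheme `X'`, the dimension does not increase: `dim X' = dim π⁻¹(U)`
(`topologicalKrullDim_eq_of_isOpenImmersion_of_denseRange`) `= dim U` (`π ∣_ U` is an
isomorphism) `≤ dim X` (`U.ι` is an embedding). Reducible `X'` included; no integrality needed.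
[folklore] -/
theorem stub_topologicalKrullDim_le_of_isIso_restrict {K : Type} [Field K] {X' X : Scheme.{0}}
    [IsNoetherian X'] (f : X ⟶ Spec (.of K)) [LocallyOfFiniteType f] (π : X' ⟶ X)
    [LocallyOfFiniteType π] (U : X.Opens) [IsIso (π ∣_ U)]
    (hd : Dense ((π ⁻¹ᵁ U : X'.Opens) : Set X')) :
    topologicalKrullDim X' ≤ topologicalKrullDim X := by
  -- adapted from Cruxes/ModificationsResolve/SketchIdeator1 (card C)
  have h1 : topologicalKrullDim (π ⁻¹ᵁ U : X'.Opens) = topologicalKrullDim X' :=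
    topologicalKrullDim_eq_of_isOpenImmersion_of_denseRange (π ≫ f) (π ⁻¹ᵁ U).ι
      (by rw [DenseRange, Scheme.Opens.range_ι]; exact hd)
  have h2 : topologicalKrullDim (π ⁻¹ᵁ U : X'.Opens) = topologicalKrullDim (U : X.Opens) :=
    IsHomeomorph.topologicalKrullDim_eq _ (Scheme.homeoOfIso (asIso (π ∣_ U))).isHomeomorph
  rw [← h1, h2]
  exact U.ι.isOpenEmbedding.isInducing.topologicalKrullDim_le

end Summit.ResolutionOfSingularities.ResolutionOfSingularities.Theorems.ModificationsResolve.Sketch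

end
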